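import Summits.BirchSwinnertonDyer.BirchSwinnertonDyer.Theorems.UniversalToricDescentSigmaFreeTransport
import Summits.BirchSwinnertonDyer.BirchSwinnertonDyer.Theorems.UniversalToricDescentStrictPlaceNoPTorsion
import Summits.BirchSwinnertonDyer.BirchSwinnertonDyer.Theorems.UniversalToricDescentNoFiniteSubmoduleOfRankOne
import Summits.BirchSwinnertonDyer.BirchSwinnertonDyer.Theorems.UniversalToricDescentTorsionMuTransportHeegner
import Summits.BirchSwinnertonDyer.BirchSwinnertonDyer.Theorems.UniversalToricDescentLambdaNormProfile
import HarnessLib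

/-!
# Route UniversalToricDescent — the ALGEBRAIC HALF of child 21845 `InvariantsTransportModThreeT` in the
# crux's binders, assembled: torsion, `μ = 0`, a generator with norm profile `λ_alg(E)`, and the λ-count
# `3^{λ_alg(E)} · #B_E^Σ[3] = 3^{n′} · #B_{E′}^Σ[3]` against the twin's frame index `n′`

Lead prover bsd-wall-utd-p1 g7 (`--supports stmt-BirchSwinnertonDyer-20399`). One theorem per reading,
nothing new mathematically: B′1 (g6 `torsionMuTransportModThree`: torsion + `μ = 0` of `X_{∅,0}(E/K_∞)`
from the twin), the norm-profile currency (g6 `UniversalToricDescentLambdaNormProfile`), (L) from (iv) at the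
degree-one strict place `𝔭′` (`UniversalToricDescentStrictPlaceNoPTorsion`), the twin's `Σ`-level torsion
from its `Σ = ∅` frame (g6 `SigmaPassage`, bad places finitely decomposed under the Heegner hypotheses),
and the `Σ`-free transport count (`UniversalToricDescentSigmaFreeTransport`), at
`Σ := {v ∤ 3 : W_K or W′_K bad at v}`:

* `invariantsTransportT_algebraicHalf` — binders of 21845 (`E` wild at `3`, mod-`3` twin `E′`, `K`
  Heegner for `N, N′`, `κ` anticyclotomic with generator `γ`, `𝔭′ ∋ 3`), the twin's input read as in T at
  ONE frame («`X_{∅,0}(E′)` torsion, `Ch·R₀⟦T⟧ = (L′)`, `profile_{n′}(L′)`»), plus the THREE extra inputs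
  the transport proof needs and T does not list: (iv) `E(ℚ₃)[3] = 0`; (N1) at `Σ = ∅` for `E`
  (dischargeable from rank-one data + Poitou–Tate ×2: `forall_finite_eq_bot_baseChange_three_of_rankOne`);
  (N1) at `Σ = ∅` for `E′` (needs the same data FOR THE TWIN — not implied by T's hypotheses).
  Conclusion: `X_{∅,0}(E)` torsion ∧ `∃ g, Ch·R₀⟦T⟧ = (g) ∧ profile_{λ}(g)` with `λ = λ_alg(E)` ∧
  `3^{λ} · #(Sel^Σ/Sel^∅)(E)[3] = 3^{n′} · #(Sel^Σ/Sel^∅)(E′)[3]`.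
* `invariantsTransportT_algebraicHalf_of_rankOne` — the same with (N1) for `E` discharged from
  `rank E(K) = 1`, `Ш(E/K)` finite, a point of infinite order, Poitou–Tate ×2 (named facts).

WHAT 21845 STILL NEEDS after this (honest): `#(Sel^Σ/Sel^∅)(E)[3]`, `#(Sel^Σ/Sel^∅)(E′)[3]` = the
`Σ`-Euler-factor terms (algebraic: `loc_Σ` onto over `K_∞`, GV00 Prop. 2.1 / Cor. 2.3 analogue; analytic:
the `Σ`-depleted frames), the analytic congruence `𝓛^Σ(f_E) ≡ u·𝓛^Σ(f_{E′})` (unprinted at `27 ∣ N`), the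
frame identification (20928), (N1) for the twin, and (iv) off the 206 classes with `E(ℚ₃)[3] ≠ 0`.
THEOREMS ONLY; no definition, no named fact, no `sorry`. BSD is not advanced by this file.
References: [GreenbergVatsal2000] Thm. (1.4), §2 Prop. (2.1), (2.4), (2.8), (2.10); [Washington1997]
§13.2; [JetchevSkinnerWan2017] §3.2–3.3; [Castella2018Erratum] Lemma 2.1; [Brink2007] Thm. 2, Cor. 1.
-/

set_option autoImplicit false
-- `…BirchSwinnertonDyer.BirchSwinnertonDyer.Theorems…` is the problem's mandated namespace (D-0017).
set_option linter.dupNamespace false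

noncomputable section

open scoped Classical

namespace Summit.BirchSwinnertonDyer.BirchSwinnertonDyer.Theorems.UniversalToricDescentInvariantsTransportT

open NumberField IsDedekindDomain Field WeierstrassCurve
open Literature.NumberTheory.EllipticCurves Literature.NumberTheory.EllipticCurves.IwasawaAlgebra
  Literature.NumberTheory.EllipticCurves.GreenbergSelmer
  Literature.NumberTheory.GaloisRepresentations Literature.NumberTheory.GaloisCohomology
  Literature.NumberTheory.EllipticCurves.Rank1Residual
  Summit.BirchSwinnertonDyer.Rank1Residual Summit.BirchSwinnertonDyer.Rank1Residual.X11b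
  Summit.BirchSwinnertonDyer.Rank1Residual.X11b.AcSelmer Summit.BirchSwinnertonDyer.Rank1Residual.Iwasawa
  Summit.BirchSwinnertonDyer.BirchSwinnertonDyer.Theorems.UniversalToricDescentAcDualMuZero
  Summit.BirchSwinnertonDyer.BirchSwinnertonDyer.Theorems.UniversalToricDescentSigmaPassage
  Summit.BirchSwinnertonDyer.BirchSwinnertonDyer.Theorems.UniversalToricDescentSigmaFree
  Summit.BirchSwinnertonDyer.BirchSwinnertonDyer.Theorems.UniversalToricDescentStrictPlace
  Summit.BirchSwinnertonDyer.BirchSwinnertonDyer.Theorems.UniversalToricDescentNoFiniteSubmodule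
  Summit.BirchSwinnertonDyer.BirchSwinnertonDyer.Theorems.UniversalToricDescentTorsionMuTransportHeegner
  Summit.BirchSwinnertonDyer.BirchSwinnertonDyer.Theorems.UniversalToricDescentLambdaNormProfile

/-- **The algebraic half of 21845, assembled** (see the module docstring for the reading of each
hypothesis and conclusion). `Σ` is the set of places of `K` prime to `3` at which `W_K` or `W′_K` has
bad reduction (finite; finitely decomposed in `K_∞` by the Heegner hypotheses and Brink's Thm. 2).
[cite: GreenbergVatsal2000, Thm. (1.4), §2 Prop. (2.8) and (2.10) (pp. 26–28)] [cite: Washington1997, §13.2]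
[cite: Castella2018Erratum, Lemma 2.1] [cite: Brink2007, Thm. 2 and Cor. 1] -/
theorem invariantsTransportT_algebraicHalf (W W' : WeierstrassCurve ℚ) [W.IsElliptic]
    [W.IsGloballyMinimal] [W'.IsElliptic] {N N' : ℕ} (K : Type) [Field K] [NumberField K]
    (hO6 : Additive.ClassO6 W 3) (hN : W.conductorNorm ℤ = N) (hcong : O6.ModPCongruent W' W 3)
    (hN' : W'.conductorNorm ℤ = N') (hK : IsImaginaryQuadratic K)
    (hHe : SatisfiesHeegnerHypothesis N K) (hHe' : SatisfiesHeegnerHypothesis N' K)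
    (κ : ZpExtension K 3) (hκ : κ.IsAnticyclotomic) (γ : absoluteGaloisGroup K)
    [Fact (κ.IsTopGenerator γ)] {𝔭' : HeightOneSpectrum (𝓞 K)} (h𝔭' : ((3 : ℕ) : 𝓞 K) ∈ 𝔭'.asIdeal)
    (hT' : Module.IsTorsion (IwasawaAlgebra 3) (XAc (W'.baseChange K) 3 κ 𝔭' ∅ γ))
    {L' : UnrSeries 3} {n' : ℕ}
    (hL' : (XAc.charIdeal (W'.baseChange K) 3 κ 𝔭' ∅ γ).map (PowerSeries.map (Halves.toUnr 3)) =
      Ideal.span {L'})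
    (hn' : (∀ i < n', ‖((PowerSeries.coeff i L' : unrIntegers 3) : ℂ_[3])‖ < 1) ∧
      ‖((PowerSeries.coeff n' L' : unrIntegers 3) : ℂ_[3])‖ = 1)
    (h4 : ∀ R : (W.baseChange ℚ_[3]).toAffine.Point, 3 • R = 0 → R = 0)
    (hnf : ∀ M : Submodule (IwasawaAlgebra 3) (XAc (W.baseChange K) 3 κ 𝔭' ∅ γ), Finite M → M = ⊥)
    (hnf' : ∀ M : Submodule (IwasawaAlgebra 3) (XAc (W'.baseChange K) 3 κ 𝔭' ∅ γ), Finite M → M = ⊥) :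
    Module.IsTorsion (IwasawaAlgebra 3) (XAc (W.baseChange K) 3 κ 𝔭' ∅ γ) ∧
      ∃ g : UnrSeries 3,
        (XAc.charIdeal (W.baseChange K) 3 κ 𝔭' ∅ γ).map (PowerSeries.map (Halves.toUnr 3)) =
            Ideal.span {g} ∧
          (∀ i < lambdaInvariant 3 (XAc (W.baseChange K) 3 κ 𝔭' ∅ γ),
            ‖((PowerSeries.coeff i g : unrIntegers 3) : ℂ_[3])‖ < 1) ∧
          ‖((PowerSeries.coeff (lambdaInvariant 3 (XAc (W.baseChange K) 3 κ 𝔭' ∅ γ)) g :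
            unrIntegers 3) : ℂ_[3])‖ = 1 ∧
          3 ^ lambdaInvariant 3 (XAc (W.baseChange K) 3 κ 𝔭' ∅ γ) *
              Nat.card {b : selmerAc (W.baseChange K) 3 κ 𝔭'
                  {v | ((3 : ℕ) : 𝓞 K) ∉ v.asIdeal ∧ (¬ (W.baseChange K).HasGoodReductionAt v ∨
                    ¬ (W'.baseChange K).HasGoodReductionAt v)} ⧸
                (selmerAc (W.baseChange K) 3 κ 𝔭' ∅).addSubgroupOf
                  (selmerAc (W.baseChange K) 3 κ 𝔭'
                    {v | ((3 : ℕ) : 𝓞 K) ∉ v.asIdeal ∧ (¬ (W.baseChange K).HasGoodReductionAt v ∨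
                      ¬ (W'.baseChange K).HasGoodReductionAt v)}) // 3 • b = 0} =
            3 ^ n' *
              Nat.card {b : selmerAc (W'.baseChange K) 3 κ 𝔭'
                  {v | ((3 : ℕ) : 𝓞 K) ∉ v.asIdeal ∧ (¬ (W.baseChange K).HasGoodReductionAt v ∨
                    ¬ (W'.baseChange K).HasGoodReductionAt v)} ⧸
                (selmerAc (W'.baseChange K) 3 κ 𝔭' ∅).addSubgroupOf
                  (selmerAc (W'.baseChange K) 3 κ 𝔭'
                    {v | ((3 : ℕ) : 𝓞 K) ∉ v.asIdeal ∧ (¬ (W.baseChange K).HasGoodReductionAt v ∨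
                      ¬ (W'.baseChange K).HasGoodReductionAt v)}) // 3 • b = 0} := by
  haveI : Fact (Nat.Prime 3) := ⟨Nat.prime_three⟩
  -- `Σ` := the places prime to `3` where one of the two curves has bad reduction
  set S : Set (HeightOneSpectrum (𝓞 K)) := {v | ((3 : ℕ) : 𝓞 K) ∉ v.asIdeal ∧
    (¬ (W.baseChange K).HasGoodReductionAt v ∨ ¬ (W'.baseChange K).HasGoodReductionAt v)} with hSdef
  have hSfin : S.Finite := by
    refine (((W.baseChange K).finite_badPlaces_holds (𝓞 K)).union
      ((W'.baseChange K).finite_badPlaces_holds (𝓞 K))).subset fun v hv ↦ ?_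
    rcases hv.2 with h | h
    · exact Or.inl h
    · exact Or.inr h
  have hSp : ∀ v ∈ S, ((3 : ℕ) : 𝓞 K) ∉ v.asIdeal := fun v hv ↦ hv.1
  have hSdec : ∀ v ∈ S, ¬ (decomp v ≤ κ.kerSubgroup) := by
    intro v hv
    rcases hv.2 with h | h
    · exact not_decomp_le_kerSubgroup_of_not_hasGoodReductionAt_baseChange W hN K hK hHe (by decide) κ
        hκ hv.1 h
    · exact not_decomp_le_kerSubgroup_of_not_hasGoodReductionAt_baseChange W' hN' K hK hHe' (by decide)
        κ hκ hv.1 h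
  have hgood : ∀ v : HeightOneSpectrum (𝓞 K), v ∉ S → ((3 : ℕ) : 𝓞 K) ∉ v.asIdeal →
      (W.baseChange K).HasGoodReductionAt v := fun v hv hpv ↦ by
    by_contra h
    exact hv ⟨hpv, Or.inl h⟩
  have hgood' : ∀ v : HeightOneSpectrum (𝓞 K), v ∉ S → ((3 : ℕ) : 𝓞 K) ∉ v.asIdeal →
      (W'.baseChange K).HasGoodReductionAt v := fun v hv hpv ↦ by
    by_contra h
    exact hv ⟨hpv, Or.inr h⟩
  -- the twin: `μ = 0` and `λ = n′` at `Σ = ∅`, then torsion + `μ = 0` at `Σ`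
  haveI := XAc.module_finite κ 𝔭' (∅ : Set (HeightOneSpectrum (𝓞 K))) γ Set.finite_empty
    (W := W'.baseChange K)
  have hμ'e : muInvariant 3 (XAc (W'.baseChange K) 3 κ 𝔭' ∅ γ) = 0 :=
    muInvariant_eq_zero_of_map_charIdeal_eq_span (XAc (W'.baseChange K) 3 κ 𝔭' ∅ γ) hT' hL'
      ⟨n', hn'.2⟩
  have hlam' : lambdaInvariant 3 (XAc (W'.baseChange K) 3 κ 𝔭' ∅ γ) = n' :=
    lambdaInvariant_eq_of_generator_normProfile (W'.baseChange K) 3 κ 𝔭' ∅ γ Set.finite_empty hT' hμ'e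
      hL' hn'
  have hfin'e : Set.Finite {s : selmerAc (W'.baseChange K) 3 κ 𝔭' ∅ | 3 • s = 0} :=
    finite_pTorsion_of_muInvariant_eq_zero (W'.baseChange K) 3 κ 𝔭' ∅ γ hT' hμ'e
  have hfin'S : Set.Finite {s : selmerAc (W'.baseChange K) 3 κ 𝔭' S | 3 • s = 0} :=
    finite_selmerAc_pTorsion_of_empty (W'.baseChange K) κ hSfin hSp hSdec hfin'e
  have hT'S : Module.IsTorsion (IwasawaAlgebra 3) (XAc (W'.baseChange K) 3 κ 𝔭' S γ) :=
    isTorsion_of_finite_pTorsion (W'.baseChange K) 3 κ 𝔭' S γ hSfin hfin'S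
  have hμ'S : muInvariant 3 (XAc (W'.baseChange K) 3 κ 𝔭' S γ) = 0 :=
    muInvariant_eq_zero_of_finite_pTorsion (W'.baseChange K) 3 κ 𝔭' S γ hSfin hfin'S
  -- (L) at the strict place `𝔭′` (degree one) from (iv), for the twin
  obtain ⟨he', hf'⟩ := degreeOne_otherPrime_three hO6 hN hK hHe h𝔭'
  have hL := noFixedPTorsion_kerSubgroup_inf_decomp_twin_of_noPTorsionPadic W 3 W' hcong h4 κ h𝔭'
    he' hf'
  -- the `Σ`-free transport
  obtain ⟨-, ⟨hT, hμ⟩, hcount⟩ :=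
    pow_lambdaInvariant_mul_natCard_baseChange_eq_of_modPCongruent W W' K κ γ (by decide) h𝔭' hSfin
      hgood hgood' hcong hL hT'S hμ'S hnf' hnf
  -- the generator with profile `λ`
  obtain ⟨g, hg, hglt, hgeq⟩ :=
    exists_generator_normProfile_lambdaInvariant (W.baseChange K) 3 κ 𝔭' ∅ γ Set.finite_empty hT hμ
  refine ⟨hT, g, hg, hglt, hgeq, ?_⟩
  rw [← hlam']
  exact hcount

/-- **The algebraic half of 21845 with (N1) for the wild curve DISCHARGED from rank-one data**
(`rank E(K) = 1`, `Ш(E/K)` finite, a point of `E(K)` of infinite order — on the route, Kolyvagin from the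
non-torsion Heegner point) and the two cited Poitou–Tate facts (leaves 20461/20462). (N1) for the
twin stays a hypothesis. [cite: GreenbergVatsal2000, Thm. (1.4), §2 Prop. (2.8) and (2.10)]
[cite: JetchevSkinnerWan2017, Prop. 3.2.1 and Lemma 3.3.3 (arXiv:1512.06894 pp. 10–12)]
[cite: MilneADT2006, Ch. I, Thm. 4.10] [cite: Kolyvagin1990, Thm. A] -/
theorem invariantsTransportT_algebraicHalf_of_rankOne (W W' : WeierstrassCurve ℚ) [W.IsElliptic]
    [W.IsGloballyMinimal] [W'.IsElliptic] {N N' : ℕ} (K : Type) [Field K] [NumberField K]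
    (hO6 : Additive.ClassO6 W 3) (hN : W.conductorNorm ℤ = N) (hcong : O6.ModPCongruent W' W 3)
    (hN' : W'.conductorNorm ℤ = N') (hK : IsImaginaryQuadratic K)
    (hHe : SatisfiesHeegnerHypothesis N K) (hHe' : SatisfiesHeegnerHypothesis N' K)
    (κ : ZpExtension K 3) (hκ : κ.IsAnticyclotomic) (γ : absoluteGaloisGroup K)
    [Fact (κ.IsTopGenerator γ)] {𝔭' : HeightOneSpectrum (𝓞 K)} (h𝔭' : ((3 : ℕ) : 𝓞 K) ∈ 𝔭'.asIdeal)
    (hT' : Module.IsTorsion (IwasawaAlgebra 3) (XAc (W'.baseChange K) 3 κ 𝔭' ∅ γ))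
    {L' : UnrSeries 3} {n' : ℕ}
    (hL' : (XAc.charIdeal (W'.baseChange K) 3 κ 𝔭' ∅ γ).map (PowerSeries.map (Halves.toUnr 3)) =
      Ideal.span {L'})
    (hn' : (∀ i < n', ‖((PowerSeries.coeff i L' : unrIntegers 3) : ℂ_[3])‖ < 1) ∧
      ‖((PowerSeries.coeff n' L' : unrIntegers 3) : ℂ_[3])‖ = 1)
    (h4 : ∀ R : (W.baseChange ℚ_[3]).toAffine.Point, 3 • R = 0 → R = 0)
    (hPT : poitouTate_selmerStructure_duality K) (hPT2 : poitouTate_sha_tateDual K)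
    (hrank : (W.baseChange K).mordellWeilRank = 1) (hSha : (W.baseChange K).ShaFinite)
    (P : (W.baseChange K).toAffine.Point) (hP : ¬ IsOfFinAddOrder P)
    (hnf' : ∀ M : Submodule (IwasawaAlgebra 3) (XAc (W'.baseChange K) 3 κ 𝔭' ∅ γ), Finite M → M = ⊥) :
    Module.IsTorsion (IwasawaAlgebra 3) (XAc (W.baseChange K) 3 κ 𝔭' ∅ γ) ∧
      ∃ g : UnrSeries 3,
        (XAc.charIdeal (W.baseChange K) 3 κ 𝔭' ∅ γ).map (PowerSeries.map (Halves.toUnr 3)) =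
            Ideal.span {g} ∧
          (∀ i < lambdaInvariant 3 (XAc (W.baseChange K) 3 κ 𝔭' ∅ γ),
            ‖((PowerSeries.coeff i g : unrIntegers 3) : ℂ_[3])‖ < 1) ∧
          ‖((PowerSeries.coeff (lambdaInvariant 3 (XAc (W.baseChange K) 3 κ 𝔭' ∅ γ)) g :
            unrIntegers 3) : ℂ_[3])‖ = 1 ∧
          3 ^ lambdaInvariant 3 (XAc (W.baseChange K) 3 κ 𝔭' ∅ γ) *
              Nat.card {b : selmerAc (W.baseChange K) 3 κ 𝔭'
                  {v | ((3 : ℕ) : 𝓞 K) ∉ v.asIdeal ∧ (¬ (W.baseChange K).HasGoodReductionAt v ∨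
                    ¬ (W'.baseChange K).HasGoodReductionAt v)} ⧸
                (selmerAc (W.baseChange K) 3 κ 𝔭' ∅).addSubgroupOf
                  (selmerAc (W.baseChange K) 3 κ 𝔭'
                    {v | ((3 : ℕ) : 𝓞 K) ∉ v.asIdeal ∧ (¬ (W.baseChange K).HasGoodReductionAt v ∨
                      ¬ (W'.baseChange K).HasGoodReductionAt v)}) // 3 • b = 0} =
            3 ^ n' *
              Nat.card {b : selmerAc (W'.baseChange K) 3 κ 𝔭'
                  {v | ((3 : ℕ) : 𝓞 K) ∉ v.asIdeal ∧ (¬ (W.baseChange K).HasGoodReductionAt v ∨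
                    ¬ (W'.baseChange K).HasGoodReductionAt v)} ⧸
                (selmerAc (W'.baseChange K) 3 κ 𝔭' ∅).addSubgroupOf
                  (selmerAc (W'.baseChange K) 3 κ 𝔭'
                    {v | ((3 : ℕ) : 𝓞 K) ∉ v.asIdeal ∧ (¬ (W.baseChange K).HasGoodReductionAt v ∨
                      ¬ (W'.baseChange K).HasGoodReductionAt v)}) // 3 • b = 0} := by
  haveI : Fact (Nat.Prime 3) := ⟨Nat.prime_three⟩
  obtain ⟨hnf, -⟩ := forall_finite_eq_bot_baseChange_three_of_rankOne W hO6 hN hK hHe h4 hPT hPT2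
    hrank hSha P hP κ γ h𝔭'
  exact invariantsTransportT_algebraicHalf W W' K hO6 hN hcong hN' hK hHe hHe' κ hκ γ h𝔭' hT' hL' hn'
    h4 hnf hnf'

/-- **The algebraic half of 21845 with BOTH (N1) hypotheses discharged from BASE FINITENESS** —
`Sel_v(K, E[3^∞])` and `Sel_v(K, E′[3^∞])` finite at every `v ∣ 3` (for `E` this is
`finite_selmerAcBase_of_rankOne` at a rank-one datum; for the twin it is an input 21845 does not carry) —
plus (iv) and the two cited Poitou–Tate facts (leaves 20461/20462): (N1) at `Σ = ∅` for each curve is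
`UniversalToricDescentNoFiniteSubmodule.forall_finite_eq_bot_baseChange_of_noPTorsionPadic`, (iv) for the
twin being transported along `E′[3] ≅ E[3]`. Conclusion as in `invariantsTransportT_algebraicHalf`.
[cite: GreenbergVatsal2000, Thm. (1.4), §2 Prop. (2.8) and (2.10)]
[cite: JetchevSkinnerWan2017, Lemma 3.3.3 (arXiv:1512.06894 pp. 11–12)] [cite: MilneADT2006, Ch. I, Thm. 4.10] -/
theorem invariantsTransportT_algebraicHalf_of_baseFinite (W W' : WeierstrassCurve ℚ) [W.IsElliptic]
    [W.IsGloballyMinimal] [W'.IsElliptic] [W'.IsGloballyMinimal] {N N' : ℕ} (K : Type) [Field K]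
    [NumberField K]
    (hO6 : Additive.ClassO6 W 3) (hN : W.conductorNorm ℤ = N) (hcong : O6.ModPCongruent W' W 3)
    (hN' : W'.conductorNorm ℤ = N') (hK : IsImaginaryQuadratic K)
    (hHe : SatisfiesHeegnerHypothesis N K) (hHe' : SatisfiesHeegnerHypothesis N' K)
    (κ : ZpExtension K 3) (hκ : κ.IsAnticyclotomic) (γ : absoluteGaloisGroup K)
    [Fact (κ.IsTopGenerator γ)] {𝔭' : HeightOneSpectrum (𝓞 K)} (h𝔭' : ((3 : ℕ) : 𝓞 K) ∈ 𝔭'.asIdeal)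
    (hT' : Module.IsTorsion (IwasawaAlgebra 3) (XAc (W'.baseChange K) 3 κ 𝔭' ∅ γ))
    {L' : UnrSeries 3} {n' : ℕ}
    (hL' : (XAc.charIdeal (W'.baseChange K) 3 κ 𝔭' ∅ γ).map (PowerSeries.map (Halves.toUnr 3)) =
      Ideal.span {L'})
    (hn' : (∀ i < n', ‖((PowerSeries.coeff i L' : unrIntegers 3) : ℂ_[3])‖ < 1) ∧
      ‖((PowerSeries.coeff n' L' : unrIntegers 3) : ℂ_[3])‖ = 1)
    (h4 : ∀ R : (W.baseChange ℚ_[3]).toAffine.Point, 3 • R = 0 → R = 0)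
    (hPT : poitouTate_selmerStructure_duality K) (hPT2 : poitouTate_sha_tateDual K)
    (hfin : ∀ v : HeightOneSpectrum (𝓞 K), ((3 : ℕ) : 𝓞 K) ∈ v.asIdeal →
      Finite (selmerAcBase (W.baseChange K) 3 v ∅))
    (hfin' : ∀ v : HeightOneSpectrum (𝓞 K), ((3 : ℕ) : 𝓞 K) ∈ v.asIdeal →
      Finite (selmerAcBase (W'.baseChange K) 3 v ∅)) :
    Module.IsTorsion (IwasawaAlgebra 3) (XAc (W.baseChange K) 3 κ 𝔭' ∅ γ) ∧
      ∃ g : UnrSeries 3,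
        (XAc.charIdeal (W.baseChange K) 3 κ 𝔭' ∅ γ).map (PowerSeries.map (Halves.toUnr 3)) =
            Ideal.span {g} ∧
          (∀ i < lambdaInvariant 3 (XAc (W.baseChange K) 3 κ 𝔭' ∅ γ),
            ‖((PowerSeries.coeff i g : unrIntegers 3) : ℂ_[3])‖ < 1) ∧
          ‖((PowerSeries.coeff (lambdaInvariant 3 (XAc (W.baseChange K) 3 κ 𝔭' ∅ γ)) g :
            unrIntegers 3) : ℂ_[3])‖ = 1 ∧
          3 ^ lambdaInvariant 3 (XAc (W.baseChange K) 3 κ 𝔭' ∅ γ) *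
              Nat.card {b : selmerAc (W.baseChange K) 3 κ 𝔭'
                  {v | ((3 : ℕ) : 𝓞 K) ∉ v.asIdeal ∧ (¬ (W.baseChange K).HasGoodReductionAt v ∨
                    ¬ (W'.baseChange K).HasGoodReductionAt v)} ⧸
                (selmerAc (W.baseChange K) 3 κ 𝔭' ∅).addSubgroupOf
                  (selmerAc (W.baseChange K) 3 κ 𝔭'
                    {v | ((3 : ℕ) : 𝓞 K) ∉ v.asIdeal ∧ (¬ (W.baseChange K).HasGoodReductionAt v ∨
                      ¬ (W'.baseChange K).HasGoodReductionAt v)}) // 3 • b = 0} =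
            3 ^ n' *
              Nat.card {b : selmerAc (W'.baseChange K) 3 κ 𝔭'
                  {v | ((3 : ℕ) : 𝓞 K) ∉ v.asIdeal ∧ (¬ (W.baseChange K).HasGoodReductionAt v ∨
                    ¬ (W'.baseChange K).HasGoodReductionAt v)} ⧸
                (selmerAc (W'.baseChange K) 3 κ 𝔭' ∅).addSubgroupOf
                  (selmerAc (W'.baseChange K) 3 κ 𝔭'
                    {v | ((3 : ℕ) : 𝓞 K) ∉ v.asIdeal ∧ (¬ (W.baseChange K).HasGoodReductionAt v ∨
                      ¬ (W'.baseChange K).HasGoodReductionAt v)}) // 3 • b = 0} := by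
  haveI : Fact (Nat.Prime 3) := ⟨Nat.prime_three⟩
  have hadd : Addv W 3 := hO6.2.1
  have hpN : 3 ∣ W.conductorNorm ℤ :=
    (W.dvd_conductorNorm_iff_not_hasGoodReductionAtPrime 3).mpr hadd.1
  have hsplit : SplitsIn K 3 := hHe 3 (Fact.out) (hN ▸ hpN)
  obtain ⟨he', hf'⟩ := degreeOne_of_splitsIn hK.1 hsplit h𝔭'
  have h4' : ∀ R : (W'.baseChange ℚ_[3]).toAffine.Point, 3 • R = 0 → R = 0 :=
    (UniversalToricDescentTowerTorsion.baseChange_noPTorsion_iff_of_modPCongruent 3 W W' ℚ_[3] hcong).mp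
      h4
  have hnf := forall_finite_eq_bot_baseChange_of_noPTorsionPadic W 3 h4 hPT hPT2 hK hsplit κ γ h𝔭'
    he' hf' hfin
  have hnf' := forall_finite_eq_bot_baseChange_of_noPTorsionPadic W' 3 h4' hPT hPT2 hK hsplit κ γ h𝔭'
    he' hf' hfin'
  exact invariantsTransportT_algebraicHalf W W' K hO6 hN hcong hN' hK hHe hHe' κ hκ γ h𝔭' hT' hL' hn'
    h4 hnf hnf'

end Summit.BirchSwinnertonDyer.BirchSwinnertonDyer.Theorems.UniversalToricDescentInvariantsTransportT

end
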